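import Summits.CriticalPhenomena.PercolationContinuityZ3.Theorems.Transplant.FKThreeApexNegCorrTri
import HarnessLib

/-!
# Connectivity correlation inequalities for `φ_{w,q}`, `0 < q ≤ 1` — ALL ADJACENT PAIRS of the weighted `K_{3,n}` (corollary of the `K_{1,1,1,n}` theorem)

Support file (`--supports stmt-CriticalPhenomena-4575`), FK sub-lane `prim-bschramm-fk-3` (gen 13); builds on p205010 (kernel theorem, internal audit
signed; external expert review pending).  No named facts, no sorries; standard axioms.  Layer 3b′ of the `K_{1,1,1,n}` programme (memo
`bschramm/prim-bschramm-fk-3/THREE-APEX.md` §4, `ADJACENT-K111N.md`).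

A weight vector supported on the apex–leaf pairs of `K_{3,n}` (`…ThreeApexWord`) is in particular supported on the pairs of `K_{1,1,1,n}`
(`fullPairs ⊇ apexPairs`, `…ThreeApexTriangle`), so `negCorr_adjacent_tri` (`…ThreeApexNegCorrTri`) specialises: **`negCorr_adjacent`** — any two
distinct edges of the weighted `K_{3,n}` with a common end-vertex (two edges at a leaf, type T1, `…ThreeApexNegCorr`; or two edges at an apex, type
T2, `…ThreeApexT2`) are negatively correlated under every `φ_{w,q}` supported on `K_{3,n}`, `0 < q ≤ 1`, every `n`, all weights; and the apex case
alone, **`negCorr_apex`**.  `NegCorrPairSupp` form: `negCorrPairSupp_adjacent`.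
[cite: Grimmett2006, §3.9 eq. (3.94), Conj. (3.96) (pp. 63–66)] [cite: Wagner2006, Conj. 5.3, §5.3 (pp. 13–15)]
-/

noncomputable section

namespace Summit.CriticalPhenomena.PercolationContinuityZ3.Theorems

namespace FK

namespace ThreeApex

open Literature.Probability.LatticeModels Literature.Probability.Percolation
open scoped Classical

variable {V : Type*} [Fintype V]
variable {a b c : V} {v : ℕ → V} {n : ℕ}
variable (hab : a ≠ b) (hac : a ≠ c) (hbc : b ≠ c) (hinj : ∀ j k, j < n → k < n → v j = v k → j = k)
  (hva : ∀ j, j < n → v j ≠ a) (hvb : ∀ j, j < n → v j ≠ b) (hvc : ∀ j, j < n → v j ≠ c)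
include hab hac hbc hinj hva hvb hvc

omit [Fintype V] hab hac hbc hinj hva hvb hvc in
/-- A weight vector vanishing off the apex–leaf pairs vanishes off the pairs of `K_{1,1,1,n}`. [folklore] -/
theorem supp_fullPairs_of_apexPairs (w : Sym2 V → unitInterval) (hsupp : ∀ e, e ∉ apexPairs a b c v n → w e = 0) :
    ∀ e, e ∉ fullPairs a b c v n → w e = 0 :=
  fun e he => hsupp e fun h => he (mem_fullPairs_of (Or.inl h))

/-- **T2 for `K_{3,n}`** — two edges from a common apex `x ∈ {a,b,c}` to distinct leaves of the weighted `K_{3,n}` are negatively correlated under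
every `φ_{w,q}` supported on `K_{3,n}`, `0 < q ≤ 1`. (transcription of bschramm/prim-bschramm-fk-3/THREE-APEX.md §4) -/
theorem negCorr_apex {q : ℝ} (hq0 : 0 < q) (hq1 : q ≤ 1) (hcard : Fintype.card V = n + 3) (w : Sym2 V → unitInterval)
    (hsupp : ∀ e, e ∉ apexPairs a b c v n → w e = 0) {j₁ j₂ : ℕ} (hj₁ : j₁ < n) (hj₂ : j₂ < n) (hne : j₁ ≠ j₂) {x : V}
    (hx : x = a ∨ x = b ∨ x = c) :
    (rcMeasureW w q ∅).real ({ω : BondConfig V | s(x, v j₁) ∈ ω} ∩ {ω | s(x, v j₂) ∈ ω}) ≤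
      (rcMeasureW w q ∅).real {ω : BondConfig V | s(x, v j₁) ∈ ω} * (rcMeasureW w q ∅).real {ω : BondConfig V | s(x, v j₂) ∈ ω} :=
  negCorrTri_apex hab hac hbc hinj hva hvb hvc hq0 hq1 hcard w (supp_fullPairs_of_apexPairs w hsupp) hj₁ hj₂ hne hx

/-- **ADJACENT PAIRS OF `K_{3,n}`** — any two distinct edges of the weighted `K_{3,n}` with a common end-vertex are negatively correlated under every
`φ_{w,q}` supported on `K_{3,n}`, `0 < q ≤ 1`, for every `n` and all weights (types T1 and T2). (transcription of bschramm/prim-bschramm-fk-3/THREE-APEX.md §4) -/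
theorem negCorr_adjacent {q : ℝ} (hq0 : 0 < q) (hq1 : q ≤ 1) (hcard : Fintype.card V = n + 3) (w : Sym2 V → unitInterval)
    (hsupp : ∀ e, e ∉ apexPairs a b c v n → w e = 0) {e f : Sym2 V} (he : e ∈ apexPairs a b c v n) (hf : f ∈ apexPairs a b c v n)
    (hfe : f ≠ e) (hadj : ∃ z : V, z ∈ e ∧ z ∈ f) :
    (rcMeasureW w q ∅).real ({ω : BondConfig V | e ∈ ω} ∩ {ω | f ∈ ω}) ≤
      (rcMeasureW w q ∅).real {ω : BondConfig V | e ∈ ω} * (rcMeasureW w q ∅).real {ω : BondConfig V | f ∈ ω} :=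
  negCorr_adjacent_tri hab hac hbc hinj hva hvb hvc hq0 hq1 hcard w (supp_fullPairs_of_apexPairs w hsupp) (mem_fullPairs_of (Or.inl he))
    (mem_fullPairs_of (Or.inl hf)) hfe hadj

/-- **`NegCorrPairSupp` form**: every ADJACENT pair of pairs of `K_{3,n}` is negatively correlated under every `φ_{w,q}` supported on the pairs of
`K_{3,n}`, `0 < q ≤ 1`. (transcription of bschramm/prim-bschramm-fk-3/THREE-APEX.md §4) -/
theorem negCorrPairSupp_adjacent {q : ℝ} (hq0 : 0 < q) (hq1 : q ≤ 1) (hcard : Fintype.card V = n + 3) {e f : Sym2 V}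
    (he : e ∈ apexPairs a b c v n) (hf : f ∈ apexPairs a b c v n) (hfe : f ≠ e) (hadj : ∃ z : V, z ∈ e ∧ z ∈ f) :
    NegCorrPairSupp (↑(apexPairs a b c v n) : Set (Sym2 V)) q e f :=
  (negCorrPairSupp_adjacent_tri hab hac hbc hinj hva hvb hvc hq0 hq1 hcard (mem_fullPairs_of (Or.inl he)) (mem_fullPairs_of (Or.inl hf))
    hfe hadj).mono (by intro g hg; exact Finset.mem_coe.2 (mem_fullPairs_of (Or.inl (Finset.mem_coe.1 hg))))

end ThreeApex

end FK

end Summit.CriticalPhenomena.PercolationContinuityZ3.Theorems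

end
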